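import Summits.BirchSwinnertonDyer.BirchSwinnertonDyer.Theorems.Rank1ResidualJetRowDualityPrep
import Summits.BirchSwinnertonDyer.BirchSwinnertonDyer.Theorems.Rank1ResidualJetPairingCountingSignsLocal
import HarnessLib

/-!
# T1 JET (cell `bsd-jet`), road K, input (L1) REDUCED to the Kummer classes: the Kolyvagin-prime local
# term equals `#(Kum_λ)^s` — the `s`-part of the LOCAL KUMMER CONDITION — by local Tate duality and
# the self-duality of `Kum_λ` (Jetchev Lemma 5.2 (i): `H¹_f^±` free of rank one over `ℤ/p^k`)

HONEST FRAMING (programme file `BSD-LIT2PART-PROGRAMME-v1.md` §HONESTY, verbatim): «no tranche here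
proves BSD; ARM L moves the LITERAL column of an r ≤ 1 census into the kernel-proved-modulo-named-print
column; ARM P changes what «named print» is worth.» THEOREMS ONLY (seat `bsd-jet-pv-1`, session g5;
`--supports stmt-BirchSwinnertonDyer-14418`, helper): no definition, no named fact, no `sorry`.
Nothing is booked; 0 classes move.

## What

The local term `hloc` of `GlobalDuality.exists_rowDuality[_modified]` ∕
`JET.tamagawaExponent_le_mInfty_of_kernelInputs_duality ∕ _weil` at a `σ`-fixed finite place `λ`:
* `relIndex_kummer_ker_eq_natCard_dual_inf` — by the signed local duality count
  (`relIndex_inf_ker_[sub|add]_id_eq_dual` with `G = ⊤`): `(Kum_λ).relIndex (ker(σ_{*,λ} − s)) =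
  #(Kum_λ^* ∩ ker(σ^D_{*,λ} − s))` (the `s`-part of the DUAL local condition on `H¹(K_λ, E[n]^D)`);
* `relIndex_kummer_ker_eq_natCard_kummer_inf` — with the Weil transport at `λ` (bijective,
  `σ`-equivariant for a datum equivariant under the adapted lift `liftAutPlace σ hfix`, and
  `w_λ⁻¹(Kum_λ^*) = Kum_λ` by n1011's self-duality of the Kummer condition): `= #(Kum_λ ∩ ker(σ_{*,λ} − s))`.
So `hloc = p^k` is EQUIVALENT to «the `s`-eigenspace of `σ_{*,λ}` on the local Kummer condition
`Kum_λ = im(E(K_λ)/p^k → H¹(K_λ, E[p^k]))` has `p^k` elements» — Jetchev Lemma 5.2 (i) (with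
`E(K_λ)/p^k ≅ Ẽ(𝔽_{ℓ²})/p^k` and `τ ↦ Frob_ℓ`, cf. x11b3 `KolyvaginFrobeniusEigenparts`); together with
`relIndex_kummer_ker_conjActPlace_eq` (singular-quotient form, `…EigenQuotientCount`) this also gives
`#(Kum_λ)^s = #(H¹/Kum_λ)^s`.

References (locators only; no cited FACT is declared): [cite: Jetchev2008, Lemma 5.2 (i)–(iii) (p. 822)]
[cite: MilneADT2006, Ch. I, Cor. 2.3, §6 proof of Prop. 6.9]. Design: no definitions; `K : Type`.
Axioms: `propext`, `Classical.choice`, `Quot.sound`.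
-/

set_option autoImplicit false

noncomputable section

open scoped Classical
open Function NumberField IsDedekindDomain WeierstrassCurve Field
open Literature.NumberTheory.EllipticCurves Literature.NumberTheory.GaloisRepresentations
open Literature.NumberTheory.GaloisCohomology
open Literature.NumberTheory.GaloisRepresentations.DiscreteGaloisModule (localTatePairingZMod
  tateDual SelmerStructure)
open Summit.BirchSwinnertonDyer.Rank1Residual.X11b.LocBridge

namespace Summit.BirchSwinnertonDyer.Rank1Residual.JET.GlobalDuality

section LocalTerm

variable {K : Type} [Field K] [NumberField K] (W : WeierstrassCurve ℚ) (σ : K ≃ₐ[ℚ] K) (N : ℕ)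
  [NeZero N] [Finite (geomTorsion (W.baseChange K) N)]

/-- **The local term through local duality**: at a `σ`-fixed finite place `λ`, for odd `N` killing
`E[N]`, a family `inv` with local duality at `λ` and compatible with `σ_*`, and `s = ±1`:
`(Kum_λ).relIndex (ker(σ_{*,λ} − s)) = #(Kum_λ^* ∩ ker(σ^D_{*,λ} − s))`. (Signed local duality count
with `G = ⊤`: `⊤^⊥ = 0`.) [cite: Jetchev2008, Lemma 5.2 (p. 822)] [cite: MilneADT2006, Ch. I, Cor. 2.3] -/
theorem relIndex_kummer_ker_eq_natCard_dual_inf (hσ : σ * σ = 1) (hN : Odd N)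
    (hM : ∀ P : geomTorsion (W.baseChange K) N, N • P = 0)
    (inv : LocalInvariants K N) (hperf : inv.IsPerfect) (hinv : inv.IsConjCompatible σ)
    {l : HeightOneSpectrum (𝓞 K)} (hfix : σ • l = l) {s : ℤ} (hs : s = 1 ∨ s = -1) :
    ((W.baseChange K).kummerSelmerStructure N (Sum.inr l)).relIndex
        ((conjActPlace W σ N hfix - s • AddMonoidHom.id _).ker) =
      Nat.card ↥(inv.dualLocalCondition ((W.baseChange K).torsionGaloisModule N) (Sum.inr l)
          ((W.baseChange K).kummerSelmerStructure N (Sum.inr l)) ⊓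
        (conjActPlaceDual W σ N N hfix - s • AddMonoidHom.id _).ker) := by
  haveI := finite_galoisCohomology_one_toLocal ((W.baseChange K).torsionGaloisModule N) l
  haveI := finite_galoisCohomology_one_tateDual_toLocal ((W.baseChange K).torsionGaloisModule N) N l
  set b := localTatePairingZMod ((W.baseChange K).torsionGaloisModule N) N (Sum.inr l : Place K)
    (inv (Sum.inr l)) with hb
  have hX : ∀ x : galoisCohomology (((W.baseChange K).torsionGaloisModule N).toLocal (Sum.inr l : Place K)) 1,
      N • x = 0 := fun x => galoisCohomology.nsmul_eq_zero_of_forall _ hM x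
  have hY : ∀ y : galoisCohomology ((((W.baseChange K).torsionGaloisModule N).tateDual N).toLocal
      (Sum.inr l : Place K)) 1, N • y = 0 := fun y => galoisCohomology.nsmul_eq_zero_of_forall _
      (fun f => DiscreteGaloisModule.TateDual.nsmul_eq_zero f) y
  have hl : Injective b := ((hperf l).2 _ hM).1.injective
  have hr : Injective b.flip := ((hperf l).2 _ hM).2.injective
  have hτX := conjActPlace_conjActPlace W σ N hσ hfix hfix
  have hτY := conjActPlaceDual_conjActPlaceDual W σ N N hσ hfix hfix
  have hcompat := localTatePairingZMod_conjActPlace W σ N N inv hinv hfix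
  have sK : ∀ x ∈ (W.baseChange K).kummerSelmerStructure N (Sum.inr l),
      conjActPlace W σ N hfix x ∈ (W.baseChange K).kummerSelmerStructure N (Sum.inr l) :=
    fun x hx => conjActPlace_mem_kummerSelmerStructure W σ N hfix hx
  have htop : (⨅ x ∈ (⊤ : AddSubgroup _), (b x).ker : AddSubgroup _) = ⊥ := by
    rw [← dualLocalCondition_eq_iInf_ker]
    exact dualLocalCondition_top_eq_bot inv hperf _ hM l
  rw [dualLocalCondition_eq_iInf_ker]
  rcases hs with rfl | rfl
  · rw [ker_sub_one_zsmul_id, ker_sub_one_zsmul_id, ← top_inf_eq (conjActPlace W σ N hfix - _).ker,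
      relIndex_inf_ker_sub_id_eq_dual hN b hX hY hl hr _ _ hτX hτY hcompat _ ⊤ le_top sK
        (fun x _ => AddSubgroup.mem_top _), htop, AddSubgroup.relIndex_bot_left]
  · rw [ker_sub_neg_one_zsmul_id, ker_sub_neg_one_zsmul_id, ← top_inf_eq (conjActPlace W σ N hfix + _).ker,
      relIndex_inf_ker_add_id_eq_dual hN b hX hY hl hr _ _ hτX hτY hcompat _ ⊤ le_top sK
        (fun x _ => AddSubgroup.mem_top _), htop, AddSubgroup.relIndex_bot_left]

variable [(W.baseChange K).IsElliptic]
  (e : geomTorsion (W.baseChange K) N → geomTorsion (W.baseChange K) N → AlgebraicClosure K)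
  (hμ : ∀ S T, e S T ^ N = 1)
  (hadd₁ : ∀ S₁ S₂ T, e (S₁ + S₂) T = e S₁ T * e S₂ T)
  (hadd₂ : ∀ S T₁ T₂, e S (T₁ + T₂) = e S T₁ * e S T₂)
  (hgal : ∀ (g : absoluteGaloisGroup K) (S T : geomTorsion (W.baseChange K) N),
    g • e S T = e (g • S) (g • T))
  (halt : ∀ T, e T T = 1) (hnondeg : ∀ T, (∀ S, e S T = 1) → T = 0)

include hμ hadd₁ hadd₂ hgal halt hnondeg in
/-- **The local term is the size of the `s`-part of the Kummer condition**: at a `σ`-fixed finite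
place `λ`, for an odd prime power `N` killing `E[N]`, a family `inv` with local duality compatible
with `σ_*`, and a Weil datum equivariant under the adapted lift `liftAutPlace σ hfix`:
`(Kum_λ).relIndex (ker(σ_{*,λ} − s)) = #(Kum_λ ∩ ker(σ_{*,λ} − s))` — local duality
(`relIndex_kummer_ker_eq_natCard_dual_inf`) transported back along the bijective, `σ`-equivariant
Weil transport at `λ`, under which `Kum_λ^*` pulls back to `Kum_λ` (n1011, Tate local duality for
`E`). So `hloc = p^k` is Jetchev's Lemma 5.2 (i) for the `s`-part.
[cite: Jetchev2008, Lemma 5.2 (i) (p. 822)] [cite: MilneADT2006, Ch. I, Cor. 3.4, §6 proof of Prop. 6.9] -/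
theorem relIndex_kummer_ker_eq_natCard_kummer_inf (hσ : σ * σ = 1) (hN : Odd N) (hNpow : IsPrimePow N)
    (hM : ∀ P : geomTorsion (W.baseChange K) N, N • P = 0)
    (inv : LocalInvariants K N) (hperf : inv.IsPerfect) (hinv : inv.IsConjCompatible σ)
    {l : HeightOneSpectrum (𝓞 K)} (hfix : σ • l = l)
    (hτe : ∀ S T, liftAutPlace σ hfix (e S T) =
      e ((isLiftOfAut_liftAutPlace σ hfix).torsionMap W N S)
        ((isLiftOfAut_liftAutPlace σ hfix).torsionMap W N T))
    {s : ℤ} (hs : s = 1 ∨ s = -1) :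
    ((W.baseChange K).kummerSelmerStructure N (Sum.inr l)).relIndex
        ((conjActPlace W σ N hfix - s • AddMonoidHom.id _).ker) =
      Nat.card ↥((W.baseChange K).kummerSelmerStructure N (Sum.inr l) ⊓
        (conjActPlace W σ N hfix - s • AddMonoidHom.id _).ker) := by
  rw [relIndex_kummer_ker_eq_natCard_dual_inf W σ N hσ hN hM inv hperf hinv hfix hs]
  -- the Weil transport at `λ` (in the `toLocal` currency): bijective, `σ`-equivariant, and pulling
  -- `Kum_λ^*` back to `Kum_λ`
  set wl := DiscreteGaloisModule.localMap
    (weilDualIntertwining (W.baseChange K) N e hμ hadd₁ hadd₂ hgal) (Sum.inr l : Place K) with hwl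
  haveI : CharZero (l.adicCompletion K) := charZero_of_injective_algebraMap (algebraMap K _).injective
  have hsd := GaloisImage.dualTransported_kummerSelmerStructure_inr (W.baseChange K) N e hμ hadd₁ hadd₂ hgal
    halt hnondeg hNpow l (localEulerPoincareCharacteristic_holds (l.adicCompletion K)) inv (hperf l).1.injective
  have inj : Injective wl :=
    map_weilDual_restrictField_injective (W.baseChange K) N e hμ hadd₁ hadd₂ hgal hnondeg
      (Place.Completion (Sum.inr l : Place K))
  have surj : Surjective wl := fun y =>
    ⟨_, map_weilDual_map_weilDualInv_restrictField (W.baseChange K) N e hμ hadd₁ hadd₂ hgal hnondeg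
      (Place.Completion (Sum.inr l : Place K)) y⟩
  have hw : ∀ x, wl (conjActPlace W σ N hfix x) = conjActPlaceDual W σ N N hfix (wl x) := fun x =>
    map_weilDual_conjActPlace W σ N e hμ hadd₁ hadd₂ hgal hfix hτe x
  have key : ∀ x, wl ((conjActPlace W σ N hfix - s • AddMonoidHom.id
        (galoisCohomology (((W.baseChange K).torsionGaloisModule N).toLocal (Sum.inr l : Place K)) 1)) x) =
      (conjActPlaceDual W σ N N hfix - s • AddMonoidHom.id
        (galoisCohomology ((((W.baseChange K).torsionGaloisModule N).tateDual N).toLocal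
          (Sum.inr l : Place K)) 1)) (wl x) := fun x => by
    rw [AddMonoidHom.sub_apply, AddMonoidHom.smul_apply, AddMonoidHom.id_apply, map_sub, map_zsmul, hw,
      AddMonoidHom.sub_apply, AddMonoidHom.smul_apply, AddMonoidHom.id_apply]
  have hcomap : (inv.dualLocalCondition ((W.baseChange K).torsionGaloisModule N) (Sum.inr l)
        ((W.baseChange K).kummerSelmerStructure N (Sum.inr l)) ⊓
      (conjActPlaceDual W σ N N hfix - s • AddMonoidHom.id _).ker).comap wl =
      (W.baseChange K).kummerSelmerStructure N (Sum.inr l) ⊓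
        (conjActPlace W σ N hfix - s • AddMonoidHom.id _).ker := by
    ext x
    rw [AddSubgroup.mem_comap, AddSubgroup.mem_inf, AddSubgroup.mem_inf, AddMonoidHom.mem_ker,
      AddMonoidHom.mem_ker, ← key, map_eq_zero_iff _ inj]
    refine and_congr_left fun _ => ?_
    rw [← LocalInvariants.dualSelmerStructure_apply, ← LocalInvariants.mem_dualTransported_iff, hsd]
  rw [← hcomap]
  have hmc := AddSubgroup.map_comap_eq_self_of_surjective surj
    (inv.dualLocalCondition ((W.baseChange K).torsionGaloisModule N) (Sum.inr l)
        ((W.baseChange K).kummerSelmerStructure N (Sum.inr l)) ⊓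
      (conjActPlaceDual W σ N N hfix - s • AddMonoidHom.id _).ker)
  exact ((congrArg (fun T : AddSubgroup (galoisCohomology ((((W.baseChange K).torsionGaloisModule N).tateDual
      N).toLocal (Sum.inr l : Place K)) 1) => Nat.card T) hmc).symm).trans
    (Nat.card_congr (AddSubgroup.equivMapOfInjective _ wl inj).toEquiv).symm

end LocalTerm

end Summit.BirchSwinnertonDyer.Rank1Residual.JET.GlobalDuality

end
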